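import Mathlib
import Summits.ValiantsHypothesis.ValiantsHypothesis.Theorems.KPlusLogSqLawWeakLiftingTowerGraftSkewBlockIdentityGraftTower

/-!
# Tower graft line — the identity-graft mechanism with the rank condition «SOME column survives at each root» (S4's object)

Calibration file for the line `Cruxes/WeakLifting/Lines/tower_graft.lean` (crux `WeakLifting` = stmt-ValiantsHypothesis-19561), object of S4
`stub_graftLawId`.  NO stub is claimed.  p702623's `skewBlock_identity_crossings` asks, at every root `ρᵢ` of `det B`, for ONE FIXED column `j`
with `det(B″ⱼ(ρᵢ)ᵀB″ⱼ(ρᵢ)) ≠ 0`.  The identity graft does not care which column: the first-order positivity `(−1)^q·χ′_{BᵀB(ρᵢ)}(0) > 0`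
(`charpoly_gram_coeff_one_pos`) needs one surviving principal `q`-minor of `BᵀB(ρᵢ)`, ANY one.  Hence:

* `skewBlock_identity_crossings'` — the same conclusion (`∃ D₀ ∀ D ≥ D₀ ∃ η > 0`, `Z₊(det G_η) = 0 ∧ Z₊(det(G_η + X^D·1)) ≥ 2N`) under
  `∀ i < N, ∃ j, det(B″ⱼ(ρᵢ)ᵀB″ⱼ(ρᵢ)) ≠ 0` (column depending on the root).  The proof is p702623's verbatim except for that one line —
  duplicated on purpose (p702623 is landed and append-only; this is the form the Descartes-sharp transfer `…IdentityGraftSharp` needs,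
  where corank one at a simple root yields SOME column, not a prescribed one).
* `skewBlock_identity_crossings'_rescaled` — the normalisation `τ_N < 1` removed by rescaling the blocks (p703592 `sum_pow_smul_rescale`).

HONEST FRAMING: linear algebra + one-variable sign persistence; nothing on S4/S4b/S5/S5ᴸ, TowerB, `WeakLifting`, Conjecture B, `MatrixDescartes`
(18050) or `VP ≠ VNP`.  Def-free.  Seat: prover val-sym-lift-p2 g20, `--supports stmt-ValiantsHypothesis-19561`.
-/

-- `Summit.ValiantsHypothesis.ValiantsHypothesis.…` repeats a component by the D-0017 layout
-- (single-conjunct summit), which the `dupNamespace` linter flags; the name is mandated.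
set_option linter.dupNamespace false

namespace Summit.ValiantsHypothesis.ValiantsHypothesis.Theorems.KPlusLogSqLaw.TowerGraft

open Polynomial Matrix
open scoped BigOperators Polynomial

section IdentityCrossingsAnyColumn

/-- p702623's `skewBlock_identity_crossings` with the rank hypothesis at the roots weakened to «some column `j = j(i)` survives».
(Proof verbatim from p702623 except for that line.) [this work] -/
theorem skewBlock_identity_crossings' {q K : ℕ} (d : Fin K → ℕ) (l₀ : Fin K) (B : Fin K → Matrix (Fin (q + 1)) (Fin (q + 1)) ℝ)
    (N : ℕ) (τ ρ : ℕ → ℝ) (hτρ : ∀ i, τ i < ρ i) (hρτ : ∀ i, ρ i < τ (i + 1)) (hτpos : ∀ i, 0 < τ i)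
    (hτN : τ N < 1)
    (hτB : ∀ i, i ≤ N → (∑ l, τ i ^ d l • B l).det ≠ 0)
    (hρB : ∀ i, i < N → (∑ l, ρ i ^ d l • B l).det = 0)
    (hρB'' : ∀ i, i < N → ∃ j : Fin (q + 1), (((∑ l, ρ i ^ d l • B l).submatrix id j.succAbove)ᵀ *
      ((∑ l, ρ i ^ d l • B l).submatrix id j.succAbove)).det ≠ 0) :
    ∃ D₀ : ℕ, ∀ D : ℕ, D₀ ≤ D → ∃ η : ℝ, 0 < η ∧
      ((∑ l, (X : ℝ[X]) ^ d l • (Matrix.fromBlocks (if l = l₀ then η • (1 : Matrix (Fin (q + 1)) (Fin (q + 1)) ℝ) else 0) (B l)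
        (B l)ᵀ (if l = l₀ then -(η • (1 : Matrix (Fin (q + 1)) (Fin (q + 1)) ℝ)) else 0)).map C).det.roots.toFinset.filter
        (fun t => 0 < t)).card = 0 ∧
      2 * N ≤ (((∑ l, (X : ℝ[X]) ^ d l • (Matrix.fromBlocks (if l = l₀ then η • (1 : Matrix (Fin (q + 1)) (Fin (q + 1)) ℝ) else 0)
          (B l) (B l)ᵀ (if l = l₀ then -(η • (1 : Matrix (Fin (q + 1)) (Fin (q + 1)) ℝ)) else 0)).map C) +
        (X : ℝ[X]) ^ D • (1 : Matrix (Fin (q + 1) ⊕ Fin (q + 1)) (Fin (q + 1) ⊕ Fin (q + 1)) ℝ[X])).det.roots.toFinset.filter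
        (fun t => 0 < t)).card := by
  classical
  set Bt : ℝ → Matrix (Fin (q + 1)) (Fin (q + 1)) ℝ := fun t => ∑ l, t ^ d l • B l with hBt
  set P : ℝ → Matrix (Fin (q + 1)) (Fin (q + 1)) ℝ := fun t => (Bt t)ᵀ * Bt t with hPdef
  set Ψ : ℝ → ℝ[X] := fun t => C ((-1 : ℝ) ^ q) * (P t).charpoly with hΨ
  have hΨeval : ∀ t σ : ℝ, (σ • (1 : Matrix (Fin (q + 1)) (Fin (q + 1)) ℝ) - P t).det = (-1 : ℝ) ^ q * (Ψ t).eval σ := by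
    intro t σ
    simp only [hΨ, eval_mul, eval_C, det_smul_one_sub_eq_eval_charpoly]
    rw [← mul_assoc, ← mul_pow, neg_one_mul, neg_neg, one_pow, one_mul]
  -- thresholds in `σ`
  have Hτ : ∀ i, ∃ s₀ : ℝ, 0 < s₀ ∧ (i ≤ N → ∀ s, 0 < s → s < s₀ → (Ψ (τ i)).eval s < 0) := by
    intro i
    by_cases hi : i ≤ N
    · have hdetP : 0 < (P (τ i)).det := by
        have : (P (τ i)).det = (Bt (τ i)).det ^ 2 := by simp only [hPdef, Matrix.det_mul, Matrix.det_transpose, sq]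
        rw [this]; exact lt_of_le_of_ne (sq_nonneg _) (Ne.symm (pow_ne_zero 2 (hτB i hi)))
      have h0 : (Ψ (τ i)).eval 0 < 0 := by
        have h1 := hΨeval (τ i) 0
        rw [zero_smul, zero_sub, Matrix.det_neg, Fintype.card_fin] at h1
        -- `(−1)^{q+1} det P = (−1)^q Ψ(0)` ⇒ `Ψ(0) = −det P`
        have : (Ψ (τ i)).eval 0 = -(P (τ i)).det := by
          have e : ((-1 : ℝ) ^ q) * ((-1 : ℝ) ^ q) = 1 := by rw [← mul_pow, neg_one_mul, neg_neg, one_pow]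
          calc (Ψ (τ i)).eval 0 = ((-1 : ℝ) ^ q * (-1) ^ q) * (Ψ (τ i)).eval 0 := by rw [e, one_mul]
            _ = (-1 : ℝ) ^ q * ((-1 : ℝ) ^ (q + 1) * (P (τ i)).det) := by rw [mul_assoc, ← h1]
            _ = -(P (τ i)).det := by rw [pow_succ, ← mul_assoc, ← mul_assoc, e, one_mul, neg_one_mul]
        rw [this]; exact neg_neg_of_pos hdetP
      obtain ⟨s₀, h1, h2⟩ := exists_pos_forall_eval_neg _ h0
      exact ⟨s₀, h1, fun _ => h2⟩
    · exact ⟨1, one_pos, fun h => absurd h hi⟩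
  have Hρ : ∀ i, ∃ s₀ : ℝ, 0 < s₀ ∧ (i < N → ∀ s, 0 < s → s < s₀ → 0 < (Ψ (ρ i)).eval s) := by
    intro i
    by_cases hi : i < N
    · have h0 : (Ψ (ρ i)).coeff 0 = 0 := by
        have hd : (P (ρ i)).det = 0 := by simp only [hPdef, Matrix.det_mul, Matrix.det_transpose, hBt, hρB i hi, mul_zero]
        have := Matrix.det_eq_sign_charpoly_coeff (P (ρ i))
        rw [hd, Fintype.card_fin] at this
        simp only [hΨ, coeff_C_mul]
        have hc : (P (ρ i)).charpoly.coeff 0 = 0 := by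
          rcases mul_eq_zero.mp this.symm with h | h
          · exact absurd h (pow_ne_zero _ (by norm_num))
          · exact h
        rw [hc, mul_zero]
      have h1 : 0 < (Ψ (ρ i)).coeff 1 := by
        simp only [hΨ, coeff_C_mul]
        obtain ⟨j, hj⟩ := hρB'' i hi
        exact charpoly_gram_coeff_one_pos (Bt (ρ i)) j hj
      obtain ⟨s₀, h2, h3⟩ := exists_pos_forall_eval_pos_of_coeff _ h0 h1
      exact ⟨s₀, h2, fun _ => h3⟩
    · exact ⟨1, one_pos, fun h => absurd h hi⟩
  choose sτ hsτ hτneg using Hτ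
  choose sρ hsρ hρpos' using Hρ
  set Sδ : Finset ℝ := (Finset.range (N + 1)).image sτ ∪ (Finset.range N).image sρ with hSδ
  have hSne : Sδ.Nonempty := ⟨sτ 0, Finset.mem_union_left _ (Finset.mem_image.mpr ⟨0, Finset.mem_range.mpr (Nat.succ_pos N), rfl⟩)⟩
  set δ := Sδ.min' hSne with hδ
  have hδpos : 0 < δ := by
    rw [hδ, Finset.lt_min'_iff]
    intro y hy
    rcases Finset.mem_union.mp hy with hy | hy
    · obtain ⟨i, -, rfl⟩ := Finset.mem_image.mp hy; exact hsτ i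
    · obtain ⟨i, -, rfl⟩ := Finset.mem_image.mp hy; exact hsρ i
  have hδτ : ∀ i, i ≤ N → δ ≤ sτ i := fun i hi =>
    Finset.min'_le _ _ (Finset.mem_union_left _ (Finset.mem_image.mpr ⟨i, Finset.mem_range.mpr (Nat.lt_succ_of_le hi), rfl⟩))
  have hδρ : ∀ i, i < N → δ ≤ sρ i := fun i hi =>
    Finset.min'_le _ _ (Finset.mem_union_right _ (Finset.mem_image.mpr ⟨i, Finset.mem_range.mpr hi, rfl⟩))
  -- the far exponent: `τ_N^D < δ` and `D ≥ d l₀`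
  obtain ⟨n, hn⟩ := exists_pow_lt_of_lt_one hδpos hτN
  refine ⟨max n (d l₀), fun D hD => ?_⟩
  have hDn : n ≤ D := le_trans (le_max_left _ _) hD
  have hDl : d l₀ ≤ D := le_trans (le_max_right _ _) hD
  -- all certificate points lie in `[τ 0, τ N]`
  set f : ℕ → ℝ := fun m => if m % 2 = 0 then τ (m / 2) else ρ (m / 2) with hf
  have hf_even : ∀ m : ℕ, m % 2 = 0 → f m = τ (m / 2) := fun m hm => by simp only [hf, if_pos hm]
  have hf_odd : ∀ m : ℕ, ¬ m % 2 = 0 → f m = ρ (m / 2) := fun m hm => by simp only [hf, if_neg hm]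
  have hf_succ : ∀ m : ℕ, f m < f (m + 1) := by
    intro m
    by_cases hm : m % 2 = 0
    · rw [hf_even m hm, hf_odd (m + 1) (by omega), show (m + 1) / 2 = m / 2 by omega]; exact hτρ _
    · rw [hf_odd m hm, hf_even (m + 1) (by omega), show (m + 1) / 2 = m / 2 + 1 by omega]; exact hρτ _
  have hf_mono : StrictMono f := strictMono_nat_of_lt_succ hf_succ
  have hf_range : ∀ m, m ≤ 2 * N → τ 0 ≤ f m ∧ f m ≤ τ N := by
    intro m hm
    have h0 : f 0 = τ 0 := hf_even 0 (by norm_num)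
    have hN' : f (2 * N) = τ N := by rw [hf_even (2 * N) (by omega), show 2 * N / 2 = N by omega]
    exact ⟨h0 ▸ hf_mono.monotone (Nat.zero_le m), hN' ▸ hf_mono.monotone hm⟩
  have hτ0lt1 : τ 0 < 1 := lt_of_le_of_lt ((hf_range 0 (Nat.zero_le _)).2 |>.trans_eq' (hf_even 0 (by norm_num)).symm |> fun h => by
    have := (hf_range 0 (Nat.zero_le _)).2; rw [hf_even 0 (by norm_num)] at this; exact this) hτN
  -- `η` and `σ(t)`
  set η : ℝ := τ 0 ^ D / 2 with hη
  have hηpos : 0 < η := by rw [hη]; exact div_pos (pow_pos (hτpos 0) D) two_pos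
  set σ : ℝ → ℝ := fun t => (η * t ^ d l₀ + t ^ D) * (t ^ D - η * t ^ d l₀) with hσ
  have hσbounds : ∀ t, τ 0 ≤ t → t ≤ τ N → 0 < σ t ∧ σ t < δ := by
    intro t ht0 ht1
    have htpos : 0 < t := (hτpos 0).trans_le ht0
    have ht1' : t < 1 := ht1.trans_lt hτN
    have hlow : η * t ^ d l₀ < t ^ D := by
      obtain ⟨e, he⟩ : ∃ e, D = d l₀ + e := ⟨D - d l₀, by omega⟩
      rw [he, pow_add]
      have h1 : τ 0 ^ D ≤ τ 0 ^ e := pow_le_pow_of_le_one (hτpos 0).le hτ0lt1.le (by omega)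
      have h2 : τ 0 ^ e ≤ t ^ e := pow_le_pow_left₀ (hτpos 0).le ht0 e
      have h3 : 0 < t ^ d l₀ := pow_pos htpos _
      have h4 : η < t ^ e := by rw [hη]; linarith [pow_pos (hτpos 0) D]
      nlinarith
    constructor
    · simp only [hσ]; exact mul_pos (by positivity) (by linarith)
    · have hup : σ t ≤ t ^ D * t ^ D := by
        simp only [hσ]; nlinarith [pow_pos htpos D, mul_pos hηpos (pow_pos htpos (d l₀))]
      have h5 : t ^ D * t ^ D = t ^ (2 * D) := by rw [← pow_add]; ring_nf
      have h6 : t ^ (2 * D) ≤ τ N ^ (2 * D) := pow_le_pow_left₀ htpos.le ht1 _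
      have h7 : τ N ^ (2 * D) ≤ τ N ^ n := pow_le_pow_of_le_one ((hτpos N).le) hτN.le (by omega)
      linarith
  refine ⟨η, hηpos, card_posRoots_det_skewBlock_pencil_eq_zero d l₀ hηpos.ne' B, ?_⟩
  -- the graft at `t`
  set h : ℝ[X] := ((∑ l, (X : ℝ[X]) ^ d l • (Matrix.fromBlocks (if l = l₀ then η • (1 : Matrix (Fin (q + 1)) (Fin (q + 1)) ℝ) else 0)
      (B l) (B l)ᵀ (if l = l₀ then -(η • (1 : Matrix (Fin (q + 1)) (Fin (q + 1)) ℝ)) else 0)).map C) +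
      (X : ℝ[X]) ^ D • (1 : Matrix (Fin (q + 1) ⊕ Fin (q + 1)) (Fin (q + 1) ⊕ Fin (q + 1)) ℝ[X])).det with hh
  have hgraft : ∀ t : ℝ, 0 < t → h.eval t = (-1 : ℝ) ^ q * (Ψ t).eval (σ t) := by
    intro t ht
    rw [hh, eval_det_pencil_add_pow_one, skewBlock_pencil_eval, ← Matrix.fromBlocks_one, Matrix.fromBlocks_smul, Matrix.fromBlocks_add]
    have hα : η * t ^ d l₀ + t ^ D ≠ 0 := by positivity
    have e1 : (η * t ^ d l₀) • (1 : Matrix (Fin (q + 1)) (Fin (q + 1)) ℝ) + t ^ D • (1 : Matrix (Fin (q + 1)) (Fin (q + 1)) ℝ) =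
        (η * t ^ d l₀ + t ^ D) • (1 : Matrix (Fin (q + 1)) (Fin (q + 1)) ℝ) := by rw [add_smul]
    have e2 : -((η * t ^ d l₀) • (1 : Matrix (Fin (q + 1)) (Fin (q + 1)) ℝ)) + t ^ D • (1 : Matrix (Fin (q + 1)) (Fin (q + 1)) ℝ) =
        (t ^ D - η * t ^ d l₀) • (1 : Matrix (Fin (q + 1)) (Fin (q + 1)) ℝ) := by rw [sub_smul]; abel
    rw [smul_zero, add_zero, add_zero, e1, e2, det_fromBlocks_smul_one _ _ hα, ← hΨeval]
  have hprod : ∀ t₁ t₂ : ℝ, 0 < t₁ → 0 < t₂ → (Ψ t₁).eval (σ t₁) * (Ψ t₂).eval (σ t₂) < 0 → h.eval t₁ * h.eval t₂ < 0 := by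
    intro t₁ t₂ ht₁ ht₂ hlt
    rw [hgraft t₁ ht₁, hgraft t₂ ht₂]
    have e : ((-1 : ℝ) ^ q) * ((-1 : ℝ) ^ q) = 1 := by rw [← mul_pow, neg_one_mul, neg_neg, one_pow]
    calc (-1 : ℝ) ^ q * (Ψ t₁).eval (σ t₁) * ((-1 : ℝ) ^ q * (Ψ t₂).eval (σ t₂))
        = (((-1 : ℝ) ^ q) * ((-1 : ℝ) ^ q)) * ((Ψ t₁).eval (σ t₁) * (Ψ t₂).eval (σ t₂)) := by ring
      _ < 0 := by rw [e, one_mul]; exact hlt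
  -- signs at the certificate points
  have hnegτ : ∀ i, i ≤ N → (Ψ (τ i)).eval (σ (τ i)) < 0 := by
    intro i hi
    have hr := hf_range (2 * i) (by omega)
    rw [hf_even (2 * i) (by omega), show 2 * i / 2 = i by omega] at hr
    obtain ⟨hs0, hs1⟩ := hσbounds (τ i) hr.1 hr.2
    exact hτneg i hi _ hs0 (hs1.trans_le (hδτ i hi))
  have hposρ : ∀ i, i < N → 0 < (Ψ (ρ i)).eval (σ (ρ i)) := by
    intro i hi
    have hr := hf_range (2 * i + 1) (by omega)
    rw [hf_odd (2 * i + 1) (by omega), show (2 * i + 1) / 2 = i by omega] at hr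
    obtain ⟨hs0, hs1⟩ := hσbounds (ρ i) hr.1 hr.2
    exact hρpos' i hi _ hs0 (hs1.trans_le (hδρ i hi))
  have hf_pos : ∀ m, 0 < f m := by
    intro m
    by_cases hm : m % 2 = 0
    · rw [hf_even m hm]; exact hτpos _
    · rw [hf_odd m hm]; exact (hτpos _).trans (hτρ _)
  have hf_alt : ∀ m : ℕ, m + 1 ≤ 2 * N → h.eval (f m) * h.eval (f (m + 1)) < 0 := by
    intro m hm
    refine hprod _ _ (hf_pos m) (hf_pos (m + 1)) ?_
    by_cases hpar : m % 2 = 0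
    · rw [hf_even m hpar, hf_odd (m + 1) (by omega), show (m + 1) / 2 = m / 2 by omega]
      exact mul_neg_of_neg_of_pos (hnegτ _ (by omega)) (hposρ _ (by omega))
    · rw [hf_odd m hpar, hf_even (m + 1) (by omega), show (m + 1) / 2 = m / 2 + 1 by omega]
      exact mul_neg_of_pos_of_neg (hposρ _ (by omega)) (hnegτ _ (by omega))
  have hcnt := Summit.ValiantsHypothesis.ValiantsHypothesis.Theorems.SymmetroidDescartes.le_card_posRoots_of_alternating h (2 * N)
    (fun i => f (i : ℕ)) (fun a b hab => hf_mono hab) (fun i => hf_pos i) (fun i => by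
      have e1 : ((Fin.castSucc i : Fin (2 * N + 1)) : ℕ) = (i : ℕ) := rfl
      have e2 : ((Fin.succ i : Fin (2 * N + 1)) : ℕ) = (i : ℕ) + 1 := rfl
      simp only [e1, e2]
      exact hf_alt i (by omega))
  simpa [hh] using hcnt

/-- `skewBlock_identity_crossings'` without the normalisation `τ_N < 1`, for the rescaled blocks `(τ_N + 1)^{dₗ}Bₗ` (cf. p703592). [this work] -/
theorem skewBlock_identity_crossings'_rescaled {q K : ℕ} (d : Fin K → ℕ) (l₀ : Fin K)
    (B : Fin K → Matrix (Fin (q + 1)) (Fin (q + 1)) ℝ) (N : ℕ) (τ ρ : ℕ → ℝ) (hτρ : ∀ i, τ i < ρ i)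
    (hρτ : ∀ i, ρ i < τ (i + 1)) (hτpos : ∀ i, 0 < τ i)
    (hτB : ∀ i, i ≤ N → (∑ l, τ i ^ d l • B l).det ≠ 0)
    (hρB : ∀ i, i < N → (∑ l, ρ i ^ d l • B l).det = 0)
    (hρB'' : ∀ i, i < N → ∃ j : Fin (q + 1), (((∑ l, ρ i ^ d l • B l).submatrix id j.succAbove)ᵀ *
      ((∑ l, ρ i ^ d l • B l).submatrix id j.succAbove)).det ≠ 0) :
    ∃ D₀ : ℕ, ∀ D : ℕ, D₀ ≤ D → ∃ η : ℝ, 0 < η ∧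
      ((∑ l, (X : ℝ[X]) ^ d l • (Matrix.fromBlocks (if l = l₀ then η • (1 : Matrix (Fin (q + 1)) (Fin (q + 1)) ℝ) else 0)
        ((τ N + 1) ^ d l • B l) ((τ N + 1) ^ d l • B l)ᵀ
        (if l = l₀ then -(η • (1 : Matrix (Fin (q + 1)) (Fin (q + 1)) ℝ)) else 0)).map C).det.roots.toFinset.filter
        (fun t => 0 < t)).card = 0 ∧
      2 * N ≤ (((∑ l, (X : ℝ[X]) ^ d l • (Matrix.fromBlocks (if l = l₀ then η • (1 : Matrix (Fin (q + 1)) (Fin (q + 1)) ℝ) else 0)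
          ((τ N + 1) ^ d l • B l) ((τ N + 1) ^ d l • B l)ᵀ
          (if l = l₀ then -(η • (1 : Matrix (Fin (q + 1)) (Fin (q + 1)) ℝ)) else 0)).map C) +
        (X : ℝ[X]) ^ D • (1 : Matrix (Fin (q + 1) ⊕ Fin (q + 1)) (Fin (q + 1) ⊕ Fin (q + 1)) ℝ[X])).det.roots.toFinset.filter
        (fun t => 0 < t)).card := by
  have hΛ : 0 < τ N + 1 := by linarith [hτpos N]
  have key : ∀ t : ℝ, (∑ l, (t / (τ N + 1)) ^ d l • ((τ N + 1) ^ d l • B l)) = ∑ l, t ^ d l • B l :=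
    fun t => sum_pow_smul_rescale d B (τ N + 1) t hΛ.ne'
  exact skewBlock_identity_crossings' d l₀ (fun l => (τ N + 1) ^ d l • B l) N (fun i => τ i / (τ N + 1))
    (fun i => ρ i / (τ N + 1)) (fun i => div_lt_div_of_pos_right (hτρ i) hΛ) (fun i => div_lt_div_of_pos_right (hρτ i) hΛ)
    (fun i => div_pos (hτpos i) hΛ) (by rw [div_lt_one hΛ]; linarith)
    (fun i hi => by rw [key]; exact hτB i hi) (fun i hi => by rw [key]; exact hρB i hi)
    (fun i hi => by rw [key]; exact hρB'' i hi)

end IdentityCrossingsAnyColumn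

end Summit.ValiantsHypothesis.ValiantsHypothesis.Theorems.KPlusLogSqLaw.TowerGraft
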